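import Summits.ResolutionOfSingularities.ResolutionOfSingularities.Theorems.AbsoluteContactHasse
import HarnessLib

/-!
# AbsoluteContactAxes — decomp-res node «AbsoluteGiraud» (lens-6 g16), tree file 5/7: §4 AXIS 1 — the EXACT
cut of `AllHug3Off3` by the
residue field of the root point: `Off3Sep` [DECIDED: THEOREM `off3Sep`, via the Hasse lemma] ∧ `Off3Insep`,
`allHug3Off3_iff_off3Insep` EXACT;
§5 AXIS 2 — ABSOLUTE CONTACT carves the residual: the NEW LEMMA `AbsContactOff3` (every core point at marking 3,
`p ≠ 3`, admits an absolute-contact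
hypersurface; PROVED in the perfect and separable-residue cases `absContactOff3_perfect` / `absContactOff3_sep`,
DESK in general), the Giraud
statement `AbsGiraud3` (PROVED in file 7/7), and THE LOCATED RESIDUAL `HypHug3Insep` (a core pure C-escaping branch
with inseparable root residue
hugging an absolute-contact hypersurface hugs a top curve); `off3Insep_of_pieces`.

Content VERBATIM from the decomp-res lens-6 g16 file `HOME/decomp-res-lens-6/g16/AbsoluteGiraud.lean` (sha256
bc25b5879a7322cd; CRITIC-LEDGER row 118
CLEARED: MAP +1; it SUPERSEDES g15 `AbsoluteContact.lean` cca8a261, rows 110–112, whose §1–§5 are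
byte-identical).  HOME = run/shared/lean/pub/decomp-res.
Host: route `MaxContactCut`, aside 31574 `PVPureGame` through the lens-6 chain SatelliteExit (tree
`Theorems/SatelliteExitClasses`) → g12–g14
BoundaryValve / SwitchExclusion / MemberCalculus (HOME, critic rows 87/93/103; not yet in the tree) → the scope
class `AllHug3Off3` (§1 here).

[WRITER NOTE (decomp-res writer g6): the lens file is split into `AbsoluteContactScope` (§0 g12 vocabulary over the
landed `Branch` + §1 the
scope class and the perfect half) → `AbsoluteContactPrimitives` (§2, landed earlier) →
`AbsoluteContactHasseRing` / `AbsoluteContactHasse` (§3a/§3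
the separable-residue Hasse lemma IN KERNEL) → `AbsoluteContactAxes` (§4/§5 the two axes: residue field of the
root point; absolute contact) →
`AbsoluteGiraudKernel` (§6 scheme-level Giraud persistence of absolute contact under one blowing up) →
`AbsoluteGiraudBranch` (§7 `absGiraud3`,
§8 assembly).  The two Theses-cone imports of the lens file (`Theses.MaxContactCut`, `MaxContactCutPurityValve`)
are unused and dropped, so every
file is route-importable; `set_option` lines dropped; nothing else changed.]
(Sources: Giraud1975; EncinasVillamayor2000 Thm. 4.9; BravoGarciaEscamillaVillamayor2012 Lemma 4.6;
VillamayorU2008ReesDiff §4; CossartPiltant2008 §2; CossartJannsenSaito2020.)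
-/

noncomputable section

open CategoryTheory AlgebraicGeometry TopologicalSpace
open Literature.AlgebraicGeometry.Resolution
open Summit.ResolutionOfSingularities.ResolutionOfSingularities.Theorems
open WeakOrderReduction ForcedTowerClasses PurityValveClasses
open SatelliteExitClasses

namespace Summit.ResolutionOfSingularities.ResolutionOfSingularities.Theorems.AbsoluteContactClasses

/-! ## §4 AXIS 1 — the EXACT cut of the aside by the residue field of the root point -/

/-- **piece A · `Off3Sep`** [DECIDED IN KERNEL (rev1 `off3Sep`) · outside `SmoothVsRegularImperfectBase` by
construction] — the `p ≠ 3` aside on the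
branches whose ROOT POINT has separable residue field: VACUOUS (no such core point). -/
def Off3Sep : Prop :=
  ∀ p : ℕ, p.Prime → p ≠ 3 → ∀ (k : Type) [Field k] [CharP k p] (B : Branch k), SepResidueAt (B.str 0) (B.pt 0) →
    IsDatum 3 (B.D 0) → (B.D 0).boundary = [] → AllCorePure p (B.str 0) (B.base 0).isRegular (B.D 0).ideal 3 →
      B.Core → B.Pure p → B.EscapingC → B.HugsTop

/-- **piece B · `Off3Insep`** [the located residual: root point with INSEPARABLE residue field] — cut further in §5. -/
def Off3Insep : Prop :=
  ∀ p : ℕ, p.Prime → p ≠ 3 → ∀ (k : Type) [Field k] [CharP k p] (B : Branch k), ¬ SepResidueAt (B.str 0) (B.pt 0) →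
    IsDatum 3 (B.D 0) → (B.D 0).boundary = [] → AllCorePure p (B.str 0) (B.base 0).isRegular (B.D 0).ideal 3 →
      B.Core → B.Pure p → B.EscapingC → B.HugsTop

/-- **kernel (EXACT, PROVED)**: the aside IS the conjunction of its two residue slices. [folklore] -/
theorem allHug3Off3_iff_residue : AllHug3Off3 ↔ Off3Sep ∧ Off3Insep := by
  classical
  constructor
  · intro h
    exact ⟨fun p hp hp3 k _ _ B _ hD hb hA hC hPu hE => h p hp hp3 k B hD hb hA hC hPu hE trivial,
      fun p hp hp3 k _ _ B _ hD hb hA hC hPu hE => h p hp hp3 k B hD hb hA hC hPu hE trivial⟩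
  · rintro ⟨hS, hI⟩ p hp hp3 k _ _ B hD hb hA hC hPu hE -
    by_cases hs : SepResidueAt (B.str 0) (B.pt 0)
    · exact hS p hp hp3 k B hs hD hb hA hC hPu hE
    · exact hI p hp hp3 k B hs hD hb hA hC hPu hE

/-- **kernel (PROVED)**: no separable-residue core points ⟹ the separable slice holds VACUOUSLY. [folklore] -/
theorem off3Sep_of_noSepCore (h : NoSepCoreOff3) : Off3Sep := by
  intro p hp hp3 k _ _ B hs hD hb hA hC hPu hE
  exact (h p hp hp3 k (B.St 0) (B.str 0) (B.base 0) (B.D 0).ideal (B.pt 0) (B.isClosed_pt 0) hs (hC 0)).elim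

/-- **piece A DECIDED modulo the PORT**. [folklore] -/
theorem off3Sep_of_port (hH : HSPortSepResidue) : Off3Sep := off3Sep_of_noSepCore (noSepCoreOff3_of_port hH)

/-- **kernel (PROVED, rev1): piece A `Off3Sep` is a THEOREM** — the separable-residue slice of the aside is
vacuous. [folklore] -/
theorem off3Sep : Off3Sep := off3Sep_of_port hsPortSepResidue

/-- **kernel (EXACT, PROVED, rev1): the whole `p ≠ 3` aside IS its inseparable-residue slice.** [folklore] -/
theorem allHug3Off3_iff_off3Insep : AllHug3Off3 ↔ Off3Insep :=
  ⟨fun h => (allHug3Off3_iff_residue.1 h).2, fun h => allHug3Off3_iff_residue.2 ⟨off3Sep, h⟩⟩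

/-- **kernel (PROVED)**: the located residual only concerns IMPERFECT ground fields (it implies nothing new over
perfect ones) — the
residual is a sub-slice of g14's `AllHug3Off3Imp`. [folklore] -/
theorem off3Insep_of_allHug3Off3Imp (h : AllHug3Off3Imp) : Off3Insep := by
  intro p hp hp3 k _ _ B hs hD hb hA hC hPu hE
  haveI : LocallyOfFiniteType (B.str 0) := (B.base 0).locallyOfFiniteType
  exact h p hp hp3 k B (not_perfectField_of_not_sepResidueAt (B.str 0) (B.isClosed_pt 0) hs) hD hb hA hC hPu hE

/-! ## §5 AXIS 2 — ABSOLUTE CONTACT carves the residual: new lemma ∧ Giraud port ∧ the hypersurface-hugging core -/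

/-- **NEW LEMMA · `AbsContactOff3`** [DESK-PROVED for every field (NODE-g15.md §3) · kernel
UNDECIDED/ATTACKABLE-L · perfect case PROVED
below · separable-residue case DECIDED-MOD-PORT below] — «on a base of the class over ANY field of
characteristic `p ≠ 3`, every closed
point of order exactly `3` of an ideal sheaf is an ABSOLUTE `Diff^{≤2}`-contact point».  Outside every
imperfect-field barrier of the
catalogue by construction (module docstring). (Sources: Matsumura1987, Thm. 26.5; EGAIV4, §16.8.) -/
def AbsContactOff3 : Prop :=
  ∀ p : ℕ, p.Prime → p ≠ 3 → ∀ (k : Type) [Field k] [CharP k p] (Y : Scheme.{0}) (g : Y ⟶ Spec (.of k)) (hB : IsBase Y g)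
    (I : Y.IdealSheafData) (y : Y), IsClosed ({y} : Set Y) → idealOrder I y = ((3 : ℕ) : ℕ∞) → IsAbsContactAt I 3 y

/-- **kernel (PROVED): the PERFECT-FIELD case of the new lemma** (Hasse contact is `k`-linear contact, which is
absolute contact). [folklore] -/
theorem absContactOff3_perfect {p : ℕ} (hp : p.Prime) (hp3 : p ≠ 3) {k : Type} [Field k] [CharP k p] [PerfectField k]
    {Y : Scheme.{0}} (g : Y ⟶ Spec (.of k)) (hB : IsBase Y g) (I : Y.IdealSheafData) {y : Y} (hy : IsClosed ({y} : Set Y))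
    (hord : idealOrder I y = ((3 : ℕ) : ℕ∞)) : IsAbsContactAt I 3 y := by
  haveI : LocallyOfFiniteType g := hB.locallyOfFiniteType
  exact isAbsContactAt_of_isContactPt g I 3 y (isContactPt_of_idealOrder_eq_three hp hp3 g hB I hy hord)

/-- **kernel (PROVED mod the lemma; outright `absContactOff3_sep` below): the SEPARABLE-RESIDUE case of the new
lemma** — so its open content is exactly the inseparable-residue
points, where the desk proof's absolute operators `Δ_α` (built from a `p`-basis) do the work. [folklore] -/
theorem absContactOff3_sep_of_port (hH : HSPortSepResidue) {p : ℕ} (hp : p.Prime) (hp3 : p ≠ 3) {k : Type} [Field k]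
    [CharP k p] {Y : Scheme.{0}} (g : Y ⟶ Spec (.of k)) (hB : IsBase Y g) (I : Y.IdealSheafData) {y : Y}
    (hy : IsClosed ({y} : Set Y)) (hsep : SepResidueAt g y) (hord : idealOrder I y = ((3 : ℕ) : ℕ∞)) :
    IsAbsContactAt I 3 y := by
  haveI : LocallyOfFiniteType g := hB.locallyOfFiniteType
  exact isAbsContactAt_of_isContactPt g I 3 y (isContactPt_of_idealOrder_eq_three_of_sep hH hp hp3 g hB I hy hsep hord)

/-- **kernel (PROVED, rev1): the SEPARABLE-RESIDUE case of the new lemma outright.** [folklore] -/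
theorem absContactOff3_sep {p : ℕ} (hp : p.Prime) (hp3 : p ≠ 3) {k : Type} [Field k]
    [CharP k p] {Y : Scheme.{0}} (g : Y ⟶ Spec (.of k)) (hB : IsBase Y g) (I : Y.IdealSheafData) {y : Y}
    (hy : IsClosed ({y} : Set Y)) (hsep : SepResidueAt g y) (hord : idealOrder I y = ((3 : ℕ) : ℕ∞)) :
    IsAbsContactAt I 3 y :=
  absContactOff3_sep_of_port hsPortSepResidue hp hp3 g hB I hy hsep hord

/-- **`B.AbsContactHypersurface`** — the branch HUGS FOR EVER (`HugsGerm`, tree) a regular hypersurface germ `V(z)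
∋ pt 0` whose equation
`z ∈ 𝔪 ∖ 𝔪²` lies in the ABSOLUTE `Diff^{≤2}`-ideal of the root stalk `𝓘_{pt 0}`: an absolute
hypersurface of maximal contact that
the branch never leaves. DEFINITION (support). -/
def _root_.Summit.ResolutionOfSingularities.ResolutionOfSingularities.Theorems.SatelliteExitClasses.Branch.AbsContactHypersurface
    {k : Type} [Field k] (B : Branch k) : Prop :=
  ∃ H : (B.St 0).IdealSheafData, HugsGerm B 0 H ∧
    ∃ z ∈ diffIdeal ℤ 2 (stalkIdeal (B.D 0).ideal (B.pt 0)),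
      stalkIdeal H (B.pt 0) = Ideal.span {z} ∧ z ∈ IsLocalRing.maximalIdeal ((B.St 0).presheaf.stalk (B.pt 0)) ∧
        z ∉ IsLocalRing.maximalIdeal ((B.St 0).presheaf.stalk (B.pt 0)) ^ 2

/-- **PORT · `AbsGiraud3`** [the tree's Giraud lemma (`DiffIdealBlowupAlgebra`, `DiffOpBlowupShiftLaw`,
`DiffOpBlowupStalkShift`, all over
`variable (k) [CommRing k]`) INSTANTIATED AT `k := ℤ` · ATTACKABLE-M (assembly along the branch: near points of a CORE branch lie on the
strict transform `(z/t)` because `z/t ∈ Diff^{≤2}_ℤ(𝓘')` and `ord 𝓘' = 3`; foreign rounds are local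
isomorphisms)] — absolute contact at
the root of a core branch is PERMANENT. (Sources: BravoGarciaEscamillaVillamayor2012, Lemma 4.6;
EncinasVillamayor2000GoodPoints, §4.) -/
def AbsGiraud3 : Prop :=
  ∀ p : ℕ, p.Prime → p ≠ 3 → ∀ (k : Type) [Field k] [CharP k p] (B : Branch k),
    IsDatum 3 (B.D 0) → B.Core → IsAbsContactAt (B.D 0).ideal 3 (B.pt 0) → B.AbsContactHypersurface

/-- **the LOCATED RESIDUAL · `HypHug3Insep`** [UNDECIDED · IDEA-NEEDED · ≡ `Off3Insep` modulo `AbsContactOff3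
∧ AbsGiraud3`; strictly
weaker as typed] — «`p ≠ 3`, any field, root point with inseparable residue field: a core, pure, C-escaping
branch of the class that hugs
an absolute-contact regular hypersurface germ hugs a top curve».  The maximal-contact-REDUCED game on a regular
excellent threefold germ
over an arbitrary field: item 31571's imperfect column (`ContactShadowClasses.NoContactHuggingTowersImperfect`), one
dimension below the
root seam.  TEST (NODE-g15.md §5): the induced marked ideal on `W = V(z)` along the (V0)-type branches `((z^p −
a)^3 + x·m₄)`. -/
def HypHug3Insep : Prop :=
  ∀ p : ℕ, p.Prime → p ≠ 3 → ∀ (k : Type) [Field k] [CharP k p] (B : Branch k), ¬ SepResidueAt (B.str 0) (B.pt 0) →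
    IsDatum 3 (B.D 0) → (B.D 0).boundary = [] → AllCorePure p (B.str 0) (B.base 0).isRegular (B.D 0).ideal 3 →
      B.Core → B.Pure p → B.EscapingC → B.AbsContactHypersurface → B.HugsTop

/-- **kernel (PROVED)**: the residual from the three pieces of AXIS 2. [folklore] -/
theorem off3Insep_of_pieces (hA : AbsContactOff3) (hG : AbsGiraud3) (hH : HypHug3Insep) : Off3Insep := by
  intro p hp hp3 k _ _ B hs hD hb hAc hC hPu hE
  have habs : IsAbsContactAt (B.D 0).ideal 3 (B.pt 0) :=
    hA p hp hp3 k (B.St 0) (B.str 0) (B.base 0) (B.D 0).ideal (B.pt 0) (B.isClosed_pt 0) (hC 0).1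
  exact hH p hp hp3 k B hs hD hb hAc hC hPu hE (hG p hp hp3 k B hD hC habs)

end Summit.ResolutionOfSingularities.ResolutionOfSingularities.Theorems.AbsoluteContactClasses
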